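import Summits.FinalStateConjecture.FinalStateConjecture.Theorems.EIHFluxBalanceInertialRecessionStubEndgameBasics

/-!
# Route EIHFluxBalance — crux `InertialRecession`, abstract endgame for general `N`:
# time-regularity of diameters/gaps and the epoch-length bounds of the hysteresis

Helper file for the crux `stmt-FinalStateConjecture-10166` (virial route, evidence note
`InertialRecession_endgame_generalN_virial.md`, §3 (H2)). Def-free real-analysis bricks:

* `abs_sup'_sub_sup'_le`, `abs_inf'_sub_inf'_le` — a finite `sup'`/`inf'` moves by at most the largest move of its entries; hence
  (`abs_norm_sub_sub_norm_sub_le`) internal diameters and external gaps of a configuration of `1`-Lipschitz motions are `2`-Lipschitz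
  in time.
* `epoch_length_lb` — HYSTERESIS: if `g, h ≥ 0` are `2`-Lipschitz on `[a, b]`, `g a ≥ Λ₂ h a` (activation level) and `g b ≤ Λ₁ h b`
  (deactivation level), `Λ₁ < Λ₂`, then `b − a ≥ (Λ₂ − Λ₁) h a / (2(1 + Λ₁))`; with `g a ≤ Λ₂ h a` as well (a crossing) this is
  `≥ (Λ₂ − Λ₁) g a / (2Λ₂(1 + Λ₁))`: epochs of a gapped node last a time proportional to its gap.
* `reactivation_gap_lb` — conversely from ratio `≤ Λ₁` back to `≥ Λ₂` takes `≥ (Λ₂ − Λ₁) h a / (2(1 + Λ₂))`.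
-/

noncomputable section

set_option linter.dupNamespace false

open Finset

namespace Summit.FinalStateConjecture.FinalStateConjecture.Theorems.SublinearIsFree.Virial

open Literature.Geometry.Lorentzian

/-! ### Finite sup/inf are non-expansive -/

/-- `|sup' f − sup' g| ≤ sup' |f − g|` on a nonempty finset. [folklore] -/
theorem abs_sup'_sub_sup'_le {ι : Type*} {s : Finset ι} (hs : s.Nonempty) (f g : ι → ℝ) :
    |s.sup' hs f - s.sup' hs g| ≤ s.sup' hs (fun i ↦ |f i - g i|) := by
  rw [abs_le]
  constructor
  · -- `sup' g ≤ sup' f + sup' |f - g|`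
    have : s.sup' hs g ≤ s.sup' hs f + s.sup' hs (fun i ↦ |f i - g i|) := by
      refine Finset.sup'_le hs g fun i hi ↦ ?_
      have h1 : f i ≤ s.sup' hs f := Finset.le_sup' f hi
      have h2 : |f i - g i| ≤ s.sup' hs (fun i ↦ |f i - g i|) := Finset.le_sup' (fun i ↦ |f i - g i|) hi
      linarith [neg_abs_le (f i - g i)]
    linarith
  · have : s.sup' hs f ≤ s.sup' hs g + s.sup' hs (fun i ↦ |f i - g i|) := by
      refine Finset.sup'_le hs f fun i hi ↦ ?_
      have h1 : g i ≤ s.sup' hs g := Finset.le_sup' g hi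
      have h2 : |f i - g i| ≤ s.sup' hs (fun i ↦ |f i - g i|) := Finset.le_sup' (fun i ↦ |f i - g i|) hi
      linarith [le_abs_self (f i - g i)]
    linarith

/-- `|inf' f − inf' g| ≤ sup' |f − g|` on a nonempty finset. [folklore] -/
theorem abs_inf'_sub_inf'_le {ι : Type*} {s : Finset ι} (hs : s.Nonempty) (f g : ι → ℝ) :
    |s.inf' hs f - s.inf' hs g| ≤ s.sup' hs (fun i ↦ |f i - g i|) := by
  rw [abs_le]
  constructor
  · -- `inf' f ≥ inf' g − sup'|f − g|`
    have : s.inf' hs g - s.sup' hs (fun i ↦ |f i - g i|) ≤ s.inf' hs f := by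
      refine Finset.le_inf' hs f fun i hi ↦ ?_
      have h1 : s.inf' hs g ≤ g i := Finset.inf'_le g hi
      have h2 : |f i - g i| ≤ s.sup' hs (fun i ↦ |f i - g i|) := Finset.le_sup' (fun i ↦ |f i - g i|) hi
      linarith [neg_abs_le (f i - g i)]
    linarith
  · have : s.inf' hs f - s.sup' hs (fun i ↦ |f i - g i|) ≤ s.inf' hs g := by
      refine Finset.le_inf' hs g fun i hi ↦ ?_
      have h1 : s.inf' hs f ≤ f i := Finset.inf'_le f hi
      have h2 : |f i - g i| ≤ s.sup' hs (fun i ↦ |f i - g i|) := Finset.le_sup' (fun i ↦ |f i - g i|) hi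
      linarith [le_abs_self (f i - g i)]
    linarith

/-- Mutual distances of `1`-Lipschitz motions are `2`-Lipschitz: `|‖a − b‖ − ‖a′ − b′‖| ≤ ‖a − a′‖ + ‖b − b′‖`. [folklore] -/
theorem abs_norm_sub_sub_norm_sub_le (a b a' b' : E3) :
    |‖a - b‖ - ‖a' - b'‖| ≤ ‖a - a'‖ + ‖b - b'‖ := by
  have h : (a - b) - (a' - b') = (a - a') - (b - b') := by abel
  calc |‖a - b‖ - ‖a' - b'‖| ≤ ‖(a - b) - (a' - b')‖ := abs_norm_sub_norm_le _ _
    _ = ‖(a - a') - (b - b')‖ := by rw [h]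
    _ ≤ ‖a - a'‖ + ‖b - b'‖ := norm_sub_le _ _

/-- A `sup'` of pairwise distances (an internal diameter, or minus an external gap via `inf'`) of motions that move by `≤ ℓ`
moves by `≤ 2ℓ`. Stated for a finset of index PAIRS `P` and two configurations `ξ, ξ′` with `‖ξ i − ξ′ i‖ ≤ ℓ` for all relevant
indices. [folklore] -/
theorem abs_sup'_dist_sub_le {ι : Type*} {P : Finset (ι × ι)} (hP : P.Nonempty) (ξ ξ' : ι → E3) {ℓ : ℝ}
    (hmove : ∀ p ∈ P, ‖ξ p.1 - ξ' p.1‖ ≤ ℓ ∧ ‖ξ p.2 - ξ' p.2‖ ≤ ℓ) :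
    |P.sup' hP (fun p ↦ ‖ξ p.1 - ξ p.2‖) - P.sup' hP (fun p ↦ ‖ξ' p.1 - ξ' p.2‖)| ≤ 2 * ℓ := by
  refine (abs_sup'_sub_sup'_le hP _ _).trans (Finset.sup'_le hP _ fun p hp ↦ ?_)
  have h := abs_norm_sub_sub_norm_sub_le (ξ p.1) (ξ p.2) (ξ' p.1) (ξ' p.2)
  linarith [(hmove p hp).1, (hmove p hp).2]

/-- Same for an `inf'` of pairwise distances (external gaps). [folklore] -/
theorem abs_inf'_dist_sub_le {ι : Type*} {P : Finset (ι × ι)} (hP : P.Nonempty) (ξ ξ' : ι → E3) {ℓ : ℝ}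
    (hmove : ∀ p ∈ P, ‖ξ p.1 - ξ' p.1‖ ≤ ℓ ∧ ‖ξ p.2 - ξ' p.2‖ ≤ ℓ) :
    |P.inf' hP (fun p ↦ ‖ξ p.1 - ξ p.2‖) - P.inf' hP (fun p ↦ ‖ξ' p.1 - ξ' p.2‖)| ≤ 2 * ℓ := by
  refine (abs_inf'_sub_inf'_le hP _ _).trans (Finset.sup'_le hP _ fun p hp ↦ ?_)
  have h := abs_norm_sub_sub_norm_sub_le (ξ p.1) (ξ p.2) (ξ' p.1) (ξ' p.2)
  linarith [(hmove p hp).1, (hmove p hp).2]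

/-! ### Hysteresis: epochs last a time proportional to the gap -/

/-- **Epoch length (H2).** If `g, h` satisfy `|g b − g a| ≤ 2(b − a)`, `|h b − h a| ≤ 2(b − a)` `0 ≤ Λ₁`,
`Λ₂·h a ≤ g a` (gapped at the activation level at time `a`) and `g b ≤ Λ₁·h b` (deactivation level at time `b`), then
`(Λ₂ − Λ₁)·h a ≤ 2(1 + Λ₁)(b − a)`. [folklore] -/
theorem epoch_length_lb' {g h : ℝ → ℝ} {a b Λ₁ Λ₂ : ℝ} (hΛ₁ : 0 ≤ Λ₁)
    (hg : |g b - g a| ≤ 2 * (b - a)) (hh : |h b - h a| ≤ 2 * (b - a))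
    (hact : Λ₂ * h a ≤ g a) (hdeact : g b ≤ Λ₁ * h b) :
    (Λ₂ - Λ₁) * h a ≤ 2 * (1 + Λ₁) * (b - a) := by
  have h1 : g a - 2 * (b - a) ≤ g b := by linarith [neg_abs_le (g b - g a)]
  have h2 : h b ≤ h a + 2 * (b - a) := by linarith [le_abs_self (h b - h a)]
  have h3 : Λ₁ * h b ≤ Λ₁ * (h a + 2 * (b - a)) := mul_le_mul_of_nonneg_left h2 hΛ₁
  nlinarith

/-- **Epoch length in terms of the gap.** Under the hypotheses of `epoch_length_lb'` and the crossing condition `g a ≤ Λ₂·h a`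
(ratio exactly `Λ₂` at activation), with `0 < Λ₂`: `(Λ₂ − Λ₁)·g a ≤ 2Λ₂(1 + Λ₁)(b − a)`. [folklore] -/
theorem epoch_length_lb_gap {g h : ℝ → ℝ} {a b Λ₁ Λ₂ : ℝ} (hΛ₁ : 0 ≤ Λ₁) (hΛ : Λ₁ < Λ₂)
    (hg : |g b - g a| ≤ 2 * (b - a)) (hh : |h b - h a| ≤ 2 * (b - a))
    (hact : Λ₂ * h a ≤ g a) (hcross : g a ≤ Λ₂ * h a) (hdeact : g b ≤ Λ₁ * h b) :
    (Λ₂ - Λ₁) * g a ≤ 2 * Λ₂ * (1 + Λ₁) * (b - a) := by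
  have hmain := epoch_length_lb' hΛ₁ hg hh hact hdeact
  have hΛ₂ : 0 < Λ₂ := hΛ₁.trans_lt hΛ
  have h1 : (Λ₂ - Λ₁) * g a ≤ (Λ₂ - Λ₁) * (Λ₂ * h a) := mul_le_mul_of_nonneg_left hcross (by linarith)
  nlinarith

/-- **Reactivation takes time.** If the ratio is `≤ Λ₁` at time `a` (`g a ≤ Λ₁ h a`) and `≥ Λ₂` at time `b` (`Λ₂ h b ≤ g b`),
with the same `2`-Lipschitz bounds and `0 ≤ Λ₁ < Λ₂`, then `(Λ₂ − Λ₁)·h a ≤ 2(1 + Λ₂)(b − a)`. [folklore] -/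
theorem reactivation_gap_lb {g h : ℝ → ℝ} {a b Λ₁ Λ₂ : ℝ} (hΛ₁ : 0 ≤ Λ₁) (hΛ : Λ₁ < Λ₂)
    (hg : |g b - g a| ≤ 2 * (b - a)) (hh : |h b - h a| ≤ 2 * (b - a))
    (hlow : g a ≤ Λ₁ * h a) (hhigh : Λ₂ * h b ≤ g b) :
    (Λ₂ - Λ₁) * h a ≤ 2 * (1 + Λ₂) * (b - a) := by
  have h1 : g b ≤ g a + 2 * (b - a) := by linarith [le_abs_self (g b - g a)]
  have h2 : h a - 2 * (b - a) ≤ h b := by linarith [neg_abs_le (h b - h a)]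
  have hΛ₂ : 0 ≤ Λ₂ := hΛ₁.trans hΛ.le
  have h3 : Λ₂ * (h a - 2 * (b - a)) ≤ Λ₂ * h b := mul_le_mul_of_nonneg_left h2 hΛ₂
  nlinarith

/-- Registered stub `epoch_length_lb` (crux `stmt-FinalStateConjecture-10166`): the hysteresis epoch-length bound (H2), one-line form of
`epoch_length_lb'`. [folklore] -/
theorem epoch_length_lb : ∀ {g h : ℝ → ℝ} {a b Λ₁ Λ₂ : ℝ}, 0 ≤ Λ₁ → |g b - g a| ≤ 2 * (b - a) → |h b - h a| ≤ 2 * (b - a) → Λ₂ * h a ≤ g a → g b ≤ Λ₁ * h b → (Λ₂ - Λ₁) * h a ≤ 2 * (1 + Λ₁) * (b - a) :=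
  fun hΛ₁ hg hh hact hdeact ↦ epoch_length_lb' hΛ₁ hg hh hact hdeact

end Summit.FinalStateConjecture.FinalStateConjecture.Theorems.SublinearIsFree.Virial

end
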